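import Literature.Algebra.Homology.SplitComplexField
import Mathlib.Algebra.Homology.HomotopyCategory
import Mathlib.Algebra.Homology.QuasiIso
import HarnessLib

/-!
# Over a field every quasi-isomorphism of cochain complexes is a homotopy equivalence

Layer `Literature/Algebra/Homology` (pure homological algebra over Mathlib; proved theorems only, 0 definitions, 0 named
facts, no instances, no notation). Consequences of `Algebra/Homology/SplitComplexField`
(`homotopyEquivHomologyOfField C : C ≃ₕ (H•(C), 0)`, Weibel Thm. 3.6.3 ∕ Cartan–Eilenberg VI.3) for UNBOUNDED cochain
complexes of vector spaces over a field `k`: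

* `isIso_of_quasiIso_of_d_eq_zero` — in any category with homology, a quasi-isomorphism between complexes WITH ZERO
  DIFFERENTIALS is an isomorphism (`isIso_iCycles`, `isIso_homologyπ`, `homologyπ_naturality`, `cyclesMap_i`);
* `quotient_map_eq_conj` — in the homotopy category, `[f] = [e_C.hom] ≫ [e_C.inv ≫ f ≫ e_D.hom] ≫ [e_D.inv]` for homotopy
  equivalences `e_C`, `e_D`;
* **`isIso_quotient_map_of_quasiIso`** — for a quasi-isomorphism `f : C ⟶ D` of cochain complexes of `k`-vector spaces,
  the class of `f` in `HomotopyCategory` is an isomorphism (conjugate `f` by the two `homotopyEquivHomologyOfField` into a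
  quasi-isomorphism of zero-differential complexes, which is an isomorphism);
* **`exists_homotopyEquiv_hom_eq_of_quasiIso : ∃ e : HomotopyEquiv C D, e.hom = f`** (Mathlib's
  `HomologicalComplex.isIso_quotient_map_iff_homotopyEquivalences`), `nonempty_homotopyEquiv_of_quasiIso`, and
  `isIso_quotient_map_iff_quasiIso` (over a field, `K(k)` already inverts exactly the quasi-isomorphisms: `D(k) = K(k)`);
* `isZero_quotient_obj_of_acyclic` — over a field an acyclic complex is contractible (zero in the homotopy category).

Cited, not restated: row `HomotopyEquivZeroDifferential` ∕ `SplitComplexFieldDecomposition` ∕ `SplitComplexField` (the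
homotopy equivalence with the homology), Mathlib's `HomotopyCategory.isoOfHomotopyEquiv` ∕ `homotopyEquivOfIso` ∕
`isIso_quotient_map_iff_homotopyEquivalences`. Mathlib (pin v4.32) proves "quasi-iso ⇒ homotopy equivalence" only for
cofibrant∕fibrant objects of its model structure (`Algebra/Homology/Factorizations`), not the field case.

Library only (cell `pub-hodge-ring2`, count-neutral); proves nothing about any crux, route or conjecture.

## References

* C. A. Weibel, *An introduction to homological algebra* (1994), Thm. 3.6.3 (proof), Ex. 1.4.3, §10.4. [Weibel1994]
* H. Cartan, S. Eilenberg, *Homological Algebra* (1956), VI.3, Thm. 3.1. [CartanEilenberg1956]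
-/

open CategoryTheory CategoryTheory.Limits HomologicalComplex

universe v u w

namespace Literature.Algebra.Homology.QuasiIsoHomotopyEquivField

/-! ### A quasi-isomorphism between complexes with zero differentials is an isomorphism -/

section ZeroDifferential

variable {V : Type u} [Category.{v} V] [Abelian V] {ι : Type w} {c : ComplexShape ι}
  {K L : HomologicalComplex V c} (φ : K ⟶ L)

/-- If `K`, `L` have zero differentials and `φ : K ⟶ L` is a quasi-isomorphism in degree `i`, then `φ.f i` is an
isomorphism: `Kⁱ ≅ Z(K)ⁱ ≅ Hⁱ(K) ⥲ Hⁱ(L) ≅ Z(L)ⁱ ≅ Lⁱ`. [cite: Weibel1994, Ex. 1.4.3] -/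
theorem isIso_f_of_quasiIsoAt_of_d_eq_zero (hK : ∀ i j, K.d i j = 0) (hL : ∀ i j, L.d i j = 0) (i : ι)
    [QuasiIsoAt φ i] : IsIso (φ.f i) := by
  haveI := K.isIso_iCycles i (c.next i) rfl (hK _ _)
  haveI := L.isIso_iCycles i (c.next i) rfl (hL _ _)
  haveI := K.isIso_homologyπ (c.prev i) i rfl (hK _ _)
  haveI := L.isIso_homologyπ (c.prev i) i rfl (hL _ _)
  have h1 : cyclesMap φ i = K.homologyπ i ≫ homologyMap φ i ≫ inv (L.homologyπ i) := by
    rw [← Category.assoc, homologyπ_naturality, Category.assoc, IsIso.hom_inv_id, Category.comp_id]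
  haveI : IsIso (cyclesMap φ i) := by
    rw [h1]
    infer_instance
  have h2 : φ.f i = inv (K.iCycles i) ≫ cyclesMap φ i ≫ L.iCycles i := by
    rw [IsIso.eq_inv_comp, cyclesMap_i]
  rw [h2]
  infer_instance

/-- **A quasi-isomorphism between complexes with zero differentials is an isomorphism.** [cite: Weibel1994, Ex. 1.4.3] -/
theorem isIso_of_quasiIso_of_d_eq_zero (hK : ∀ i j, K.d i j = 0) (hL : ∀ i j, L.d i j = 0) [QuasiIso φ] : IsIso φ := by
  haveI : ∀ i, IsIso (φ.f i) := fun i => isIso_f_of_quasiIsoAt_of_d_eq_zero φ hK hL i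
  exact Hom.isIso_of_components φ

end ZeroDifferential

/-! ### Conjugating by homotopy equivalences in the homotopy category -/

section Conj

variable {V : Type u} [Category.{v} V] [Preadditive V] {ι : Type w} {c : ComplexShape ι}
  {C C' D D' : HomologicalComplex V c} (eC : HomotopyEquiv C C') (eD : HomotopyEquiv D D') (f : C ⟶ D)

/-- In the homotopy category, `[f] = [e_C.hom] ≫ [e_C.inv ≫ f ≫ e_D.hom] ≫ [e_D.inv]`. [cite: Weibel1994, §10.4] -/
theorem quotient_map_eq_conj :
    (HomotopyCategory.quotient V c).map f =
      (HomotopyCategory.quotient V c).map eC.hom ≫ (HomotopyCategory.quotient V c).map (eC.inv ≫ f ≫ eD.hom) ≫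
        (HomotopyCategory.quotient V c).map eD.inv := by
  have hC := (HomotopyCategory.isoOfHomotopyEquiv eC).hom_inv_id
  have hD := (HomotopyCategory.isoOfHomotopyEquiv eD).hom_inv_id
  simp only [HomotopyCategory.isoOfHomotopyEquiv] at hC hD
  simp only [Functor.map_comp, Category.assoc]
  rw [hD, Category.comp_id, ← Category.assoc, hC, Category.id_comp]

/-- Hence `[f]` is an isomorphism as soon as `[e_C.inv ≫ f ≫ e_D.hom]` is. [cite: Weibel1994, §10.4] -/
theorem isIso_quotient_map_of_isIso_conj [IsIso ((HomotopyCategory.quotient V c).map (eC.inv ≫ f ≫ eD.hom))] :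
    IsIso ((HomotopyCategory.quotient V c).map f) := by
  rw [quotient_map_eq_conj eC eD f]
  haveI : IsIso ((HomotopyCategory.quotient V c).map eC.hom) :=
    (inferInstance : IsIso (HomotopyCategory.isoOfHomotopyEquiv eC).hom)
  haveI : IsIso ((HomotopyCategory.quotient V c).map eD.inv) :=
    (inferInstance : IsIso (HomotopyCategory.isoOfHomotopyEquiv eD).inv)
  infer_instance

end Conj

/-! ### The field case -/

section Field

variable {k : Type u} [Field k] {C D : CochainComplex (ModuleCat.{u} k) ℤ} (f : C ⟶ D)

/-- **Over a field the class of a quasi-isomorphism in the homotopy category is an isomorphism.**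
[cite: Weibel1994, Thm. 3.6.3 (proof)] [cite: CartanEilenberg1956, VI.3 Thm. 3.1] -/
theorem isIso_quotient_map_of_quasiIso [QuasiIso f] :
    IsIso ((HomotopyCategory.quotient _ _).map f) := by
  let eC := homotopyEquivHomologyOfField C
  let eD := homotopyEquivHomologyOfField D
  haveI : QuasiIso (eC.inv ≫ f ≫ eD.hom) := inferInstance
  haveI : IsIso (eC.inv ≫ f ≫ eD.hom) :=
    isIso_of_quasiIso_of_d_eq_zero _ (fun _ _ => rfl) (fun _ _ => rfl)
  exact isIso_quotient_map_of_isIso_conj eC eD f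

/-- **Over a field every quasi-isomorphism of (unbounded) cochain complexes is a homotopy equivalence**, with the given
map as `hom`. [cite: Weibel1994, Thm. 3.6.3 (proof)] [cite: CartanEilenberg1956, VI.3 Thm. 3.1] -/
theorem exists_homotopyEquiv_hom_eq_of_quasiIso [QuasiIso f] : ∃ e : HomotopyEquiv C D, e.hom = f :=
  (HomologicalComplex.isIso_quotient_map_iff_homotopyEquivalences f).1 (isIso_quotient_map_of_quasiIso f)

/-- Over a field, quasi-isomorphic cochain complexes are homotopy equivalent. [cite: Weibel1994, Thm. 3.6.3 (proof)] -/
theorem nonempty_homotopyEquiv_of_quasiIso [QuasiIso f] : Nonempty (HomotopyEquiv C D) :=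
  ⟨(exists_homotopyEquiv_hom_eq_of_quasiIso f).choose⟩

/-- **Over a field, a chain map is a quasi-isomorphism iff its class in the homotopy category is an isomorphism**
(`K(k)` inverts exactly the quasi-isomorphisms). [cite: Weibel1994, §10.4] [cite: Weibel1994, Thm. 3.6.3 (proof)] -/
theorem isIso_quotient_map_iff_quasiIso : IsIso ((HomotopyCategory.quotient _ _).map f) ↔ QuasiIso f := by
  refine ⟨fun h => ?_, fun _ => isIso_quotient_map_of_quasiIso f⟩
  obtain ⟨e, he⟩ := (HomologicalComplex.isIso_quotient_map_iff_homotopyEquivalences f).1 h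
  rw [← he]
  infer_instance

/-- **Over a field an acyclic cochain complex is contractible**: it is a zero object of the homotopy category.
[cite: Weibel1994, Thm. 3.6.3 (proof)] -/
theorem isZero_quotient_obj_of_acyclic (hC : C.Acyclic) : IsZero ((HomotopyCategory.quotient _ _).obj C) := by
  have hZ : IsZero (zeroDifferential (ComplexShape.up ℤ) fun i => C.homology i) := by
    rw [IsZero.iff_id_eq_zero]
    refine HomologicalComplex.hom_ext _ _ fun i => ?_
    exact ((exactAt_iff_isZero_homology _ _).1 (hC i)).eq_of_src _ _
  exact IsZero.of_iso ((HomotopyCategory.quotient _ _).map_isZero hZ)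
    (HomotopyCategory.isoOfHomotopyEquiv (homotopyEquivHomologyOfField C))

end Field

end Literature.Algebra.Homology.QuasiIsoHomotopyEquivField
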